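import Literature.AnabelianGeometry.AbsoluteAnabelian.AbsTopIII.CyclotomicSynchronization
import Literature.AnabelianGeometry.AbsoluteAnabelian.FundamentalExtensionCuspidalSchemata
import Literature.AnabelianGeometry.AbsoluteAnabelian.GaloisCyclotomeZHatOne
import Literature.AnabelianGeometry.EtaleTheta.CyclotomeZHatEquiv
import Literature.NumberTheory.GaloisRepresentations.FiniteGroupAveraging
import HarnessLib

/-!
# [AbsTopIII] Thm. 1.9 (b) / Cor. 1.10 (ii)(c) relative to a `CurveModel`: the universal closures of
# the schema rows F-0346 `CurveModel.Thm_1_9_b` and F-0348 `CurveModel.Cor_1_10_ii_c` are REFUTED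

S. Mochizuki, *Topics in Absolute Anabelian Geometry III*, §1 (kurims manuscript, lit key
`paper:url-5493eb38cbb7`): Thm. 1.9 (b) p. 37 "One constructs the natural isomorphisms
`I_z ⥲ μ_Ẑ(Π_U) := M_Z`"; Cor. 1.10 (ii)(c) p. 42 "One constructs the natural isomorphism
`μ_Ẑ(G_k) ⥲ μ_Ẑ(Π_X)`" (the cyclotomic synchronization).  Cell abc-iut, block F (fact-proving wave),
seat abc-iut-f-079, FACT-LIST tranche 79; PROOF-ONLY companion of `CuspidalSynchronization.lean` /
`CyclotomicSynchronization.lean` (abc-iut-L4-t1; imported, never edited; no `def`, no instance, no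
named fact — every witness is built inside a theorem term).

Both rows are NAMED FACTS RELATIVE TO an interface `M : CurveModel` (typing policy θ; FACT-LIST
`kernel_closedness = parametrised`).  The interface carries NO axiom tying `M.ext`, `M.cusps`, `M.res`
to any geometry, and both conclusions assert an isomorphism onto the INTRINSIC geometric cyclotome
`M_X = Hom(H²(Δ_X, Ẑ), Ẑ)` (`CyclotomeMod`, Mathlib continuous cohomology).  This file records, with
kernel proofs:

* `subsingleton_continuousCohomology_two_of_subsingleton` — **`H²_cont(1, X) = 0`** for the trivial
  group and ANY topological module `X` (Mathlib's homogeneous cochains: a `2`-cochain `c` of the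
  one-element group is `d` of the constant `1`-cochain with value `c(1,1,1)`, since
  `(d F)(g,h,l) = F(h,l) - F(g,l) + F(g,h)`); hence
  `CyclotomeMod.subsingleton_of_geom_eq_bot` — **`M_X(Λ)` is trivial whenever `Δ_X = 1`**;
* `CurveModel.not_forall_thm_1_9_b` — **F-0346, universal closure REFUTED** (universe `0`): witness
  interface with two index points, `U ↦ (Π_U = Ẑ × G_ℚ ↠ G_ℚ)` carrying ONE rational cusp `z` with
  `D_z = Π_U`, `I_z = Δ_U = Ẑ × 1` free procyclic (`isFreeProcyclic_zHatCompletion`), and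
  `Z ↦` the point extension `Π_Z = G_ℚ` (`Δ_Z = 1`, so `M_Z` is trivial): no bijection `I_z ≃ M_Z`;
* `CurveModel.not_forall_cor_1_10_ii_c` — **F-0348, universal closure REFUTED** (universe `0`): the
  one-point interface over the MLF `ℚ_p` with the point extension `Π_X = G_{ℚ_p}` (`M_X` trivial),
  against `μ_Ẑ(G_{ℚ_p}) ≠ 1` — by the tree's PROVED local class field theory
  `exists_muZhat_mulEquiv_cyclotome_units_of_isMLF` (`μ_Ẑ(G_k) ≅ Λ(k̄ˣ)`) and the generator of
  `Λ(k̄ˣ)` (`cyclotome.exists_generator_mulEquiv_zHat_of_isSepClosed`, a primitive square root of `1`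
  is `≠ 1`).

Consequence of record (R5): each row is consumable only AT A NAMED MODEL `M` — as the cone does
(`nonempty_cuspidalSynchronization (h9 : M.Thm_1_9_b) (h10 : M.Cor_1_10_ii_c)`,
`GaloisCyclotomeGalSect.lean`) and as the conditional discharge `Thm19bPresentationsProofs.lean`
(Thm. 1.9 (b) at every model satisfying the Prop. 1.4 named facts) does — never as a closure over all
interfaces.  The witnesses are NOT models of any curve.

HONEST FRAMING: statements about OUR typed interface, not about print's Thm. 1.9 / Cor. 1.10
([AbsTopIII] is a refereed paper, typed statements-first, D-0014); typed ≠ proved; no model of any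
curve is asserted to exist; nothing here bears on the disputed [IUTchIII] Cor. 3.12; no side taken.
-/

noncomputable section

open CategoryTheory Topology

namespace Literature.AnabelianGeometry.AbsoluteAnabelian

open Literature.NumberTheory.GaloisRepresentations
open _root_.TopRep _root_.ContRepresentation _root_.ContinuousCohomology

universe u

/-! ### `H²` of the trivial group vanishes (any coefficients) -/

section TrivialGroup

variable {k : Type*} [CommRing k] [TopologicalSpace k]
variable {G : Type u} [Group G] [TopologicalSpace G] [IsTopologicalGroup G] [Subsingleton G]

/-- **`H²_cont(G, X) = 0` for the trivial group `G`** and every topological `G`-module `X` (no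
discreteness needed): in Mathlib's homogeneous model a `2`-cochain `c ∈ C(G, C(G, C(G, X)))` of the
one-element group is the coboundary of the constant `1`-cochain with value `c(1,1,1)`, because
`(d F)(g,h,l) = F(h,l) - F(g,l) + F(g,h)`. [cite: SerreGaloisCohomology1997, I §2.2] -/
theorem subsingleton_continuousCohomology_two_of_subsingleton (X : TopRep.{u} k G) :
    Subsingleton (continuousCohomology 2 X) := by
  have h0 : Subsingleton ((homogeneousCochains X).homology (1 + 1)) := by
    rw [subsingleton_homology_succ_iff]
    intro σ _
    -- the constant `1`-cochain with value `σ 1 1 1`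
    let a : X := (σ.1 : C(G, C(G, C(G, X)))) 1 1 1
    let τ : C(G, C(G, X)) := ContinuousMap.const G (ContinuousMap.const G a)
    have hτ : τ ∈ (resolutionX X 2).ρ.invariants := by
      refine (mem_invariants _).2 fun g => ?_
      rw [Subsingleton.elim g 1, map_one]
      rfl
    refine ⟨⟨τ, hτ⟩, Subtype.ext (ContinuousMap.ext fun g => ContinuousMap.ext fun h =>
      ContinuousMap.ext fun l => ?_)⟩
    rw [cochains_d_coe, d_two_apply]
    obtain rfl : g = 1 := Subsingleton.elim _ _
    obtain rfl : h = 1 := Subsingleton.elim _ _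
    obtain rfl : l = 1 := Subsingleton.elim _ _
    change a - a + a = a
    rw [sub_self, zero_add]
  exact h0

end TrivialGroup

namespace AbsTopIII

/-! ### `M_X(Λ) = Hom(H²(Δ_X, Λ), Λ)` is trivial when `Δ_X = 1` -/

/-- **The geometric cyclotome of an extension with trivial `Δ` is trivial**: if `Δ_E = 1` then
`H²(Δ_E, Λ) = 0` (`subsingleton_continuousCohomology_two_of_subsingleton`), so
`M_E(Λ) = Hom(H²(Δ_E, Λ), Λ)` (`CyclotomeMod E Λ`) has exactly one element.  (For a PROPER hyperbolic
curve `Δ_X` is a surface group and `M_X ≅ Ẑ`; the point is that the INTERFACE does not exclude `Δ = 1`.)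
[cite: MochizukiAbsTopIII2015, Prop 1.4 (ii) p.31] -/
theorem CyclotomeMod.subsingleton_of_geom_eq_bot (E : FundamentalExtension.{u}) (Λ : Type u)
    [AddCommGroup Λ] [TopologicalSpace Λ] [IsTopologicalAddGroup Λ] (hE : E.geom = ⊥) :
    Subsingleton (CyclotomeMod E Λ) := by
  haveI : Subsingleton E.geom := by
    rw [hE]
    infer_instance
  haveI : Subsingleton (geomH2 E Λ) :=
    subsingleton_continuousCohomology_two_of_subsingleton (geomTrivialRep E Λ)
  refine ⟨fun f g => ?_⟩
  change (CyclotomeMod.toDual f : geomH2 E Λ →ₗ[ℤ] Λ) = CyclotomeMod.toDual g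
  exact LinearMap.ext fun x => by
    have hx : x = 0 := Subsingleton.elim _ _
    subst hx
    rw [map_zero, map_zero]

/-! ### F-0346: the universal closure of `CurveModel.Thm_1_9_b` over ALL interfaces is false -/

namespace CurveModel

open FundamentalExtension

/-- **FACT-LIST F-0346, universal closure REFUTED** (universe `0`).  WITNESS DATA (not a model of any
curve): the index category `Bool` over `k := ℚ`; `U := true ↦` the extension `Π_U = Ẑ × G_ℚ ↠ G_ℚ`
(second projection; `Ẑ` = Mathlib's profinite completion of `ℤ`) with ONE cusp `z`, `D_z = Π_U` (so `z`
is rational), `I_z = D_z ∩ Δ_U = Ẑ × 1`, free procyclic (`isFreeProcyclic_zHatCompletion`);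
`Z := false ↦` the point extension `Π_Z = G_ℚ = G_ℚ` (`Δ_Z = 1`), no cusps; `U ⊆ Z` the only cofinite
open, `res =` the projection; all curves flagged scheme-like and proper of genus `2`.  Every HYPOTHESIS
of `Thm_1_9_b` holds at `(U, Z, z)`, but `M_Z = Hom(H²(1, Ẑ), Ẑ)` is trivial
(`CyclotomeMod.subsingleton_of_geom_eq_bot`) while `I_z ≅ Ẑ` is not (`not_isFreeProcyclic_of_subsingleton`):
there is no bijection `I_z ≃ M_Z`, let alone a `D_z`-equivariant one.  So "`∀ M, Thm_1_9_b M`" is not a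
theorem: the row [AbsTopIII] Thm. 1.9 (b) is consumable only AT A NAMED MODEL (R5) — this refutes OUR
`∀ M`-reading of a shape-(M) schema, not print's Theorem 1.9 (b).
[cite: MochizukiAbsTopIII2015, Thm 1.9 (b) p.37] -/
theorem not_forall_thm_1_9_b :
    ¬ ∀ M : CurveModel.{0},
      Literature.AnabelianGeometry.AbsoluteAnabelian.AbsTopIII.CurveModel.Thm_1_9_b M := by
  intro h
  -- the two extensions over `G_ℚ`
  let Γ : ProfiniteGrp.{0} := absoluteGaloisGrp ℚ
  let Z : ProfiniteGrp.{0} := ProfiniteGrp.ProfiniteCompletion.completion (GrpCat.of (Multiplicative ℤ))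
  let EU : FundamentalExtension.{0} :=
    { arith := ProfiniteGrp.of (Z × Γ), gal := Γ, aug := ContinuousMonoidHom.snd Z Γ,
      aug_surjective := Prod.snd_surjective }
  let Ept : FundamentalExtension.{0} :=
    { arith := Γ, gal := Γ, aug := ContinuousMonoidHom.id _, aug_surjective := Function.surjective_id }
  have hEpt : Ept.geom = ⊥ := (MonoidHom.ker_eq_bot_iff _).mpr Function.injective_id
  -- `I_z = Δ_U = Ẑ × 1 ≅ Ẑ` is free procyclic
  have hmem : ∀ z : Z, ((z, 1) : Z × Γ) ∈ EU.geom := fun z => EU.mem_geom.2 rfl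
  have eZ : (Z : Type) ≃ₜ* EU.geom :=
    { toFun := fun z => ⟨(z, 1), hmem z⟩
      invFun := fun g => g.1.1
      left_inv := fun _ => rfl
      right_inv := fun g => Subtype.ext (Prod.ext rfl (EU.mem_geom.1 g.2).symm)
      map_mul' := fun z z' => Subtype.ext (Prod.ext rfl (mul_one _).symm)
      continuous_toFun := (continuous_id.prodMk continuous_const).subtype_mk hmem
      continuous_invFun := continuous_fst.comp continuous_subtype_val }
  have hfree : IsFreeProcyclic EU.geom := isFreeProcyclic_zHatCompletion.of_continuousMulEquiv eZ
  -- cuspidal data: one cusp on `U` with `D_z = Π_U`; none on `Z`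
  let CU : EU.CuspidalData :=
    { Cusp := PUnit
      Dcusp := fun _ => ⊤
      Icusp := fun _ => EU.geom
      Icusp_eq := fun _ => (top_inf_eq EU.geom).symm
      isClosed_Dcusp := fun _ => by
        rw [Subgroup.coe_top]
        exact isClosed_univ
      eq_of_conj := fun x y _ _ => Subsingleton.elim x y }
  let Cpt : Ept.CuspidalData :=
    { Cusp := PEmpty
      Dcusp := fun c => c.elim
      Icusp := fun c => c.elim
      Icusp_eq := fun c => c.elim
      isClosed_Dcusp := fun c => c.elim
      eq_of_conj := fun c => c.elim }
  -- the surjection `Π_U ↠ Π_Z`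
  let r : EU ⟶ Ept := ⟨ContinuousMonoidHom.snd Z Γ, ContinuousMonoidHom.id _, fun _ => rfl⟩
  let ext : ULift.{1, 0} Bool → FundamentalExtension.{0} := fun b => cond b.down EU Ept
  let M : CurveModel.{0} :=
    { Curve := ULift.{1, 0} Bool
      base := fun _ => ℚ
      ext := ext
      galIso := fun b => Bool.rec (motive := fun c => ((cond c EU Ept).gal ≅ absoluteGaloisGrp ℚ))
        (Iso.refl _) (Iso.refl _) b.down
      cusps := fun b => Bool.rec (motive := fun c => (cond c EU Ept).CuspidalData) Cpt CU b.down
      IsProper := fun _ => True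
      IsScheme := fun _ => True
      genus := fun _ => 2
      FunctionField := fun _ => ℚ
      Point := fun _ => PEmpty
      decomp := fun _ x => x.elim
      IsNFCurve := fun _ => False
      IsNFPoint := fun _ x => x.elim
      IsNFRational := fun _ _ => False
      IsNFConstant := fun _ _ => False
      NFFunctionField := fun _ => ℚ
      IsStrictlyBelyiType := fun _ => False
      IsCofiniteOpen := fun U U' => U.down = true ∧ U'.down = false
      res := fun {U U'} hUU' =>
        eqToHom (show ext U = EU by dsimp only [ext]; rw [hUU'.1]; rfl) ≫ r ≫
          eqToHom (show Ept = ext U' by dsimp only [ext]; rw [hUU'.2]; rfl) }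
  have hrat : ∀ c : (M.cusps (ULift.up true)).Cusp, (M.cusps (ULift.up true)).IsRational c :=
    fun _ g _ => ⟨((1 : Z), g), Subgroup.mem_top _, rfl⟩
  obtain ⟨φ, -⟩ := h M (ULift.up true) (ULift.up false) ⟨rfl, rfl⟩ trivial trivial trivial le_rfl
    hrat PUnit.unit hfree
  haveI : Subsingleton (CyclotomeMod (M.ext (ULift.up false)) ZHatCoeff.{0}) :=
    CyclotomeMod.subsingleton_of_geom_eq_bot Ept _ hEpt
  haveI : Subsingleton EU.geom := φ.injective.subsingleton
  exact not_isFreeProcyclic_of_subsingleton hfree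

/-! ### F-0348: the universal closure of `CurveModel.Cor_1_10_ii_c` over ALL interfaces is false -/

/-- **FACT-LIST F-0348, universal closure REFUTED** (universe `0`).  WITNESS DATA (not a model of any
curve): for a prime `p`, the one-object index category over the MLF `ℚ_p` with the point extension
`Π_X = G_{ℚ_p} = G_{ℚ_p}` (`Δ_X = 1`), no cusps, `res = 𝟙`, flagged scheme-like and proper of genus `2`.
Every HYPOTHESIS of `Cor_1_10_ii_c` holds at `(X, X)`, but the geometric cyclotome `M_X` is trivial
(`CyclotomeMod.subsingleton_of_geom_eq_bot`) while the Galois cyclotome `μ_Ẑ(G_{ℚ_p})` is NOT: by the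
tree's PROVED local class field theory `μ_Ẑ(G_k) ≅ Λ(k̄ˣ)` (`exists_muZhat_mulEquiv_cyclotome_units_of_isMLF`,
[AbsAnab] Prop. 1.2.1 (vi)) and the generator of `Λ(k̄ˣ) ≅ Ẑ` whose level-`2` component is a primitive
square root of unity, hence `≠ 1` (`cyclotome.exists_generator_mulEquiv_zHat_of_isSepClosed`).  So
"`∀ M, Cor_1_10_ii_c M`" is not a theorem: the row [AbsTopIII] Cor. 1.10 (ii)(c) is consumable only AT A
NAMED MODEL (R5) — this refutes OUR `∀ M`-reading of a shape-(M) schema, not print's Corollary 1.10 (ii).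
[cite: MochizukiAbsTopIII2015, Cor 1.10 (ii) p.42] -/
theorem not_forall_cor_1_10_ii_c :
    ¬ ∀ M : CurveModel.{0},
      Literature.AnabelianGeometry.AbsoluteAnabelian.AbsTopIII.CurveModel.Cor_1_10_ii_c M := by
  intro h
  haveI : Fact (Nat.Prime 2) := ⟨Nat.prime_two⟩
  have hk : IsMLF ℚ_[2] := by
    refine ⟨⟨2, inferInstance, RingHom.id _, ?_⟩⟩
    letI : Algebra ℚ_[2] ℚ_[2] := (RingHom.id ℚ_[2]).toAlgebra
    exact Module.Finite.of_surjective (Algebra.linearMap ℚ_[2] ℚ_[2]) fun y => ⟨y, rfl⟩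
  let Ept : FundamentalExtension.{0} :=
    { arith := absoluteGaloisGrp ℚ_[2], gal := absoluteGaloisGrp ℚ_[2], aug := ContinuousMonoidHom.id _,
      aug_surjective := Function.surjective_id }
  have hEpt : Ept.geom = ⊥ := (MonoidHom.ker_eq_bot_iff _).mpr Function.injective_id
  let Cpt : Ept.CuspidalData :=
    { Cusp := PEmpty
      Dcusp := fun c => c.elim
      Icusp := fun c => c.elim
      Icusp_eq := fun c => c.elim
      isClosed_Dcusp := fun c => c.elim
      eq_of_conj := fun c => c.elim }
  let M : CurveModel.{0} :=
    { Curve := PUnit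
      base := fun _ => ℚ_[2]
      ext := fun _ => Ept
      galIso := fun _ => Iso.refl _
      cusps := fun _ => Cpt
      IsProper := fun _ => True
      IsScheme := fun _ => True
      genus := fun _ => 2
      FunctionField := fun _ => ℚ_[2]
      Point := fun _ => PEmpty
      decomp := fun _ x => x.elim
      IsNFCurve := fun _ => False
      IsNFPoint := fun _ x => x.elim
      IsNFRational := fun _ _ => False
      IsNFConstant := fun _ _ => False
      NFFunctionField := fun _ => ℚ_[2]
      IsStrictlyBelyiType := fun _ => False
      IsCofiniteOpen := fun _ _ => True
      res := fun _ => 𝟙 _ }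
  obtain ⟨φ, -⟩ := h M PUnit.unit PUnit.unit trivial trivial trivial trivial le_rfl hk
  haveI : Subsingleton (CyclotomeMod (M.ext PUnit.unit) ZHatCoeff.{0}) :=
    CyclotomeMod.subsingleton_of_geom_eq_bot Ept _ hEpt
  -- hence `μ_Ẑ(G_{ℚ_2})` would be trivial
  have hμ : Subsingleton (muZhat (Field.absoluteGaloisGroup ℚ_[2])) := φ.injective.subsingleton
  -- but it is `≅ Λ(ℚ̄_2ˣ) ∋ ξ ≠ 1`
  obtain ⟨e, -⟩ := exists_muZhat_mulEquiv_cyclotome_units_of_isMLF ℚ_[2] hk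
  haveI : CharZero (AlgebraicClosure ℚ_[2]) :=
    charZero_of_injective_algebraMap (algebraMap ℚ_[2] (AlgebraicClosure ℚ_[2])).injective
  obtain ⟨ξ, -, hξ, -⟩ :=
    EtaleTheta.cyclotome.exists_generator_mulEquiv_zHat_of_isSepClosed (AlgebraicClosure ℚ_[2])
  have hξ1 : ξ ≠ 1 := fun h1 => by
    have h2 := hξ 2
    rw [h1] at h2
    exact h2.ne_one (by decide) rfl
  haveI : Subsingleton (EtaleTheta.cyclotome (AlgebraicClosure ℚ_[2])ˣ) := e.symm.injective.subsingleton
  exact hξ1 (Subsingleton.elim _ _)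

end CurveModel

end AbsTopIII

end Literature.AnabelianGeometry.AbsoluteAnabelian

end
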